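import Mathlib.Analysis.Calculus.ParametricIntervalIntegral
import Mathlib.MeasureTheory.Integral.IntervalIntegral.FundThmCalculus
import HarnessLib

/-!
# The time derivative of the space-derivative field from the space derivative of the
# time-derivative field (a "strong Schwarz theorem" for two-parameter families in Banach spaces)

Analysis/Calculus support file (everything proved; no definitions, no named facts).  Let
`g : ℝ → E → F` be a two-parameter family (`t` a real "time", `y` in an open subset `U` of a real
normed space `E`, values in a real Banach space `F`) on the open set `O = (a, b) × U`, with

* a time-derivative field `V`: `∂ₜ g(t, y) = V(t, y)` on `O`, `t ↦ V(t, y)` continuous on `(a, b)`;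
* which is Fréchet differentiable in `y` with derivative the operator field `M`:
  `D_y V(t, ·)(y) = M(t, y)` on `O`, and `M` is JOINTLY continuous on `O` in operator norm;
* and `y ↦ g(t, y)` differentiable at the points of `O`.

Then the space-derivative field `W(t, y) = D_y g(t, ·)(y)` is differentiable in `t` IN OPERATOR NORM
with derivative `M(t, y)` (`hasDerivAt_fderiv_of_hasFDerivAt_deriv`): `∂ₜ ∂_y g = ∂_y ∂ₜ g`, the
existence of the left-hand side being part of the conclusion.  This is the classical strong form of the
theorem on mixed partials (Rudin, *Principles*, Thm. 9.41: if `D₁f`, `D₂₁f` exist and `D₂₁f` is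
continuous then `D₁₂f` exists and equals `D₂₁f`), in the Banach-space setting and proved through the
integral: near `y₀`, `g(t, y) − g(t₀, y) = ∫_{t₀}^{t} V(s, y) ds` (fundamental theorem of calculus),
differentiation under the integral sign (`intervalIntegral.hasFDerivAt_integral_of_dominated_of_fderiv_le`,
the operator field being bounded near `(t₀, y₀)` by joint continuity) gives
`W(t, y₀) = W(t₀, y₀) + ∫_{t₀}^{t} M(s, y₀) ds`, and the fundamental theorem of calculus once more
(`intervalIntegral.integral_hasDerivAt_right`).  It is the form in which evolution equations with a
smooth solution map deliver the mixed second derivative of `(t, y) ↦ g(t, y)` from the linearisation of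
the vector field (the `y`-derivative of `∂ₜ g = G(g)`).

## Mathlib / tree search

Mathlib: `second_derivative_symmetric`, `ContDiffAt.isSymmSndFDerivAt` (symmetry at `C²` points — the
joint `C²` regularity is what is being built here, not assumed); `lean search 'mixed partial'`,
`'D₂₁'`, `'Schwarz'`: the tree's `Literature/Analysis/Calculus/MixedPartials.lean` treats `C²` maps
`ℝ × ℝ → V` through the symmetric second derivative; `JointSmoothnessPartials.lean` merges partial
derivative FIELDS into joint regularity (it consumes the present statement).  Nothing proves existence
of `∂ₜ ∂_y` from `∂_y ∂ₜ`.

## References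

* W. Rudin, *Principles of Mathematical Analysis*, 3rd ed., Thm. 9.41.
* J. Dieudonné, *Foundations of Modern Analysis* (1960), (8.12.3) (interchange of partial derivatives)
  and (8.11.2) (differentiation under the integral sign).
-/

open Set Filter MeasureTheory intervalIntegral Metric
open scoped Topology Interval

namespace Literature.Analysis.Calculus

variable {E F : Type*} [NormedAddCommGroup E] [NormedSpace ℝ E] [NormedAddCommGroup F]
  [NormedSpace ℝ F] [CompleteSpace F]

omit [NormedSpace ℝ E] in
/-- **A jointly continuous operator field is bounded on a box around each point of an open product**:
if `M` is continuous on `(a, b) × U` (`U` open) then around `(t₀, y₀) ∈ (a, b) × U` there are `ε, ρ > 0`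
with `[t₀ − ε, t₀ + ε] ⊆ (a, b)`, `ball y₀ ρ ⊆ U` and `‖M(s, y)‖ ≤ ‖M(t₀, y₀)‖ + 1` on the box
(continuity at the point in the sup metric of the product). [folklore] -/
theorem exists_box_norm_le_of_continuousOn {G : Type*} [NormedAddCommGroup G] {a b : ℝ} {U : Set E}
    (hU : IsOpen U) {M : ℝ → E → G} (hMc : ContinuousOn (fun q : ℝ × E => M q.1 q.2) (Ioo a b ×ˢ U))
    {t₀ : ℝ} {y₀ : E} (ht₀ : t₀ ∈ Ioo a b) (hy₀ : y₀ ∈ U) :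
    ∃ ε > (0 : ℝ), ∃ ρ > (0 : ℝ), Icc (t₀ - ε) (t₀ + ε) ⊆ Ioo a b ∧ ball y₀ ρ ⊆ U ∧
      ∀ s ∈ Icc (t₀ - ε) (t₀ + ε), ∀ y ∈ ball y₀ ρ, ‖M s y‖ ≤ ‖M t₀ y₀‖ + 1 := by
  have hO : IsOpen (Ioo a b ×ˢ U) := isOpen_Ioo.prod hU
  have hq₀ : (t₀, y₀) ∈ Ioo a b ×ˢ U := ⟨ht₀, hy₀⟩
  have hc : ContinuousAt (fun q : ℝ × E => M q.1 q.2) (t₀, y₀) := hMc.continuousAt (hO.mem_nhds hq₀)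
  obtain ⟨δ, hδ, hδM⟩ := Metric.continuousAt_iff.1 hc 1 one_pos
  obtain ⟨δ', hδ', hδ'O⟩ := Metric.isOpen_iff.1 hO (t₀, y₀) hq₀
  refine ⟨min δ δ' / 2, by positivity, min δ δ' / 2, by positivity, ?_, ?_, ?_⟩
  · intro s hs
    have hmem : (s, y₀) ∈ ball (t₀, y₀) δ' := by
      rw [mem_ball, Prod.dist_eq, dist_self, Real.dist_eq]
      refine max_lt ?_ hδ'
      have : |s - t₀| ≤ min δ δ' / 2 := abs_sub_le_iff.2 ⟨by linarith [hs.2], by linarith [hs.1]⟩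
      linarith [min_le_right δ δ']
    exact (hδ'O hmem).1
  · intro y hy
    have hmem : (t₀, y) ∈ ball (t₀, y₀) δ' := by
      rw [mem_ball, Prod.dist_eq, dist_self]
      refine max_lt hδ' ?_
      linarith [mem_ball.1 hy, min_le_right δ δ']
    exact (hδ'O hmem).2
  · intro s hs y hy
    have hdist : dist (s, y) (t₀, y₀) < δ := by
      rw [Prod.dist_eq, Real.dist_eq]
      refine max_lt ?_ ?_
      · have : |s - t₀| ≤ min δ δ' / 2 := abs_sub_le_iff.2 ⟨by linarith [hs.2], by linarith [hs.1]⟩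
        linarith [min_le_left δ δ']
      · linarith [mem_ball.1 hy, min_le_left δ δ']
    have h := hδM hdist
    rw [dist_eq_norm] at h
    calc ‖M s y‖ = ‖(M s y - M t₀ y₀) + M t₀ y₀‖ := by rw [sub_add_cancel]
      _ ≤ ‖M s y - M t₀ y₀‖ + ‖M t₀ y₀‖ := norm_add_le _ _
      _ ≤ ‖M t₀ y₀‖ + 1 := by linarith

/-- **`∂ₜ ∂_y g = ∂_y ∂ₜ g` — existence of the left-hand side included (strong Schwarz theorem in Banach
spaces).**  On `O = (a, b) × U` (`U` open in `E`) let `∂ₜ g(t, y) = V(t, y)` with `t ↦ V(t, y)` continuous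
on `(a, b)` for `y ∈ U`, let `y ↦ V(t, y)` have Fréchet derivative `M(t, y)` at the points of `O` with `M`
jointly continuous on `O` in operator norm, and let `y ↦ g(t, y)` be differentiable at the points of `O`.
Then `t ↦ D_y g(t, ·)(y)` has derivative `M(t, y)` (in `E →L F`) at every `(t, y) ∈ O`.  Proof:
`g(t, ·) − g(t₀, ·) = ∫_{t₀}^{t} V(s, ·) ds` near `y₀`; differentiate under the integral sign (`M` is bounded
on a box around `(t₀, y₀)`), so `D_y g(t, ·)(y₀) = D_y g(t₀, ·)(y₀) + ∫_{t₀}^{t} M(s, y₀) ds` for `t` near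
`t₀`, whose `t`-derivative at `t₀` is `M(t₀, y₀)` (Rudin, *Principles*, Thm. 9.41; Dieudonné (8.12.3)).
[folklore] -/
theorem hasDerivAt_fderiv_of_hasFDerivAt_deriv {a b : ℝ} {U : Set E} (hU : IsOpen U)
    {g V : ℝ → E → F} {M : ℝ → E → E →L[ℝ] F}
    (hg : ∀ q ∈ Ioo a b ×ˢ U, HasDerivAt (fun t => g t q.2) (V q.1 q.2) q.1)
    (hVc : ∀ y ∈ U, ContinuousOn (fun t => V t y) (Ioo a b))
    (hV : ∀ q ∈ Ioo a b ×ˢ U, HasFDerivAt (fun y => V q.1 y) (M q.1 q.2) q.2)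
    (hMc : ContinuousOn (fun q : ℝ × E => M q.1 q.2) (Ioo a b ×ˢ U))
    (hd : ∀ q ∈ Ioo a b ×ˢ U, DifferentiableAt ℝ (fun y => g q.1 y) q.2) :
    ∀ q ∈ Ioo a b ×ˢ U, HasDerivAt (fun t => fderiv ℝ (fun y => g t y) q.2) (M q.1 q.2) q.1 := by
  rintro ⟨t₀, y₀⟩ ⟨ht₀, hy₀⟩
  obtain ⟨ε, hε, ρ, hρ, hIcc, hball, hbound⟩ := exists_box_norm_le_of_continuousOn hU hMc ht₀ hy₀
  -- ### Step 1: `g t − g t₀ = ∫_{t₀}^{t} V` near `y₀`, and its `y`-derivative is `∫_{t₀}^{t} M(·, y₀)`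
  have hsub : ∀ t ∈ Icc (t₀ - ε) (t₀ + ε), uIcc t₀ t ⊆ Icc (t₀ - ε) (t₀ + ε) := fun t ht =>
    uIcc_subset_Icc ⟨by linarith, by linarith⟩ ht
  have hVcont : ∀ y ∈ U, ∀ t ∈ Icc (t₀ - ε) (t₀ + ε), ContinuousOn (fun s => V s y) (uIcc t₀ t) :=
    fun y hy t ht => (hVc y hy).mono ((hsub t ht).trans hIcc)
  have hFTC : ∀ t ∈ Icc (t₀ - ε) (t₀ + ε), ∀ y ∈ ball y₀ ρ,
      g t y - g t₀ y = ∫ s in t₀..t, V s y := by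
    intro t ht y hy
    rw [integral_eq_sub_of_hasDerivAt (f := fun s => g s y) (f' := fun s => V s y)
      (fun s hs => hg (s, y) ⟨hIcc (hsub t ht hs), hball hy⟩) ((hVcont y (hball hy) t ht).intervalIntegrable)]
  have hMcont : ContinuousOn (fun s => M s y₀) (Ioo a b) :=
    hMc.comp (continuousOn_id.prodMk continuousOn_const) fun s hs => ⟨hs, hy₀⟩
  have hD : ∀ t ∈ Icc (t₀ - ε) (t₀ + ε),
      HasFDerivAt (fun y => g t y - g t₀ y) (∫ s in t₀..t, M s y₀) y₀ := by
    intro t ht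
    have hΙ : Ι t₀ t ⊆ Icc (t₀ - ε) (t₀ + ε) := uIoc_subset_uIcc.trans (hsub t ht)
    have h := intervalIntegral.hasFDerivAt_integral_of_dominated_of_fderiv_le (μ := volume)
      (F := fun y s => V s y) (F' := fun y s => M s y) (x₀ := y₀) (a := t₀) (b := t)
      (bound := fun _ => ‖M t₀ y₀‖ + 1) (ball_mem_nhds y₀ hρ)
      (by
        filter_upwards [hU.mem_nhds hy₀] with y hy
        exact ((hVc y hy).mono ((uIoc_subset_uIcc.trans (hsub t ht)).trans hIcc)).aestronglyMeasurable
          measurableSet_uIoc)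
      ((hVcont y₀ hy₀ t ht).intervalIntegrable)
      ((hMcont.mono (hΙ.trans hIcc)).aestronglyMeasurable measurableSet_uIoc)
      (Eventually.of_forall fun s hs y hy => hbound s (hΙ hs) y hy)
      intervalIntegrable_const
      (Eventually.of_forall fun s hs y hy => hV (s, y) ⟨hIcc (hΙ hs), hball hy⟩)
    refine h.congr_of_eventuallyEq ?_
    filter_upwards [ball_mem_nhds y₀ hρ] with y hy
    exact hFTC t ht y hy
  -- ### Step 2: `W t = W t₀ + ∫_{t₀}^{t} M(·, y₀)` for `t` near `t₀`
  have hW : ∀ t ∈ Icc (t₀ - ε) (t₀ + ε), fderiv ℝ (fun y => g t y) y₀ =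
      fderiv ℝ (fun y => g t₀ y) y₀ + ∫ s in t₀..t, M s y₀ := by
    intro t ht
    have h0 : HasFDerivAt (fun y => g t₀ y) (fderiv ℝ (fun y => g t₀ y) y₀) y₀ :=
      (hd (t₀, y₀) ⟨ht₀, hy₀⟩).hasFDerivAt
    have h1 : HasFDerivAt (fun y => g t y)
        (fderiv ℝ (fun y => g t₀ y) y₀ + ∫ s in t₀..t, M s y₀) y₀ := by
      convert h0.add (hD t ht) using 1
      funext y
      try simp only [Pi.add_apply]
      abel
    exact h1.fderiv
  -- ### Step 3: differentiate the right-hand side in `t` at `t₀`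
  have hIoo : Ioo a b ∈ 𝓝 t₀ := isOpen_Ioo.mem_nhds ht₀
  have hint : HasDerivAt (fun t => ∫ s in t₀..t, M s y₀) (M t₀ y₀) t₀ :=
    integral_hasDerivAt_right IntervalIntegrable.refl
      (hMcont.stronglyMeasurableAtFilter isOpen_Ioo t₀ ht₀) (hMcont.continuousAt hIoo)
  have hsum : HasDerivAt (fun t => fderiv ℝ (fun y => g t₀ y) y₀ + ∫ s in t₀..t, M s y₀) (M t₀ y₀) t₀ := by
    simpa using hint.const_add (fderiv ℝ (fun y => g t₀ y) y₀)
  refine hsum.congr_of_eventuallyEq ?_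
  have hnhds : Icc (t₀ - ε) (t₀ + ε) ∈ 𝓝 t₀ := Icc_mem_nhds (by linarith) (by linarith)
  filter_upwards [hnhds] with t ht
  exact hW t ht

end Literature.Analysis.Calculus
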